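import Summits.ABC.IUTFork.Cor312VolumesArchSummands
import Summits.ABC.IUTFork.Thm311Real
import Literature.IUT.LogThetaLattice.PacketLogVolumesHaarModelCapsulesArchHulls
import HarnessLib

/-!
# The Cor 3.12 crew's archimedean container at `(j, ∞)` IS the genuine capsule model at `A = S^±_{j+1}` on hull-sets
# (junction abc-iut-L6 ↔ C312 at the archimedean place; abc-iut cell, row CAP39, abc-iut-L6-d3)

S. Mochizuki, *Inter-universal Teichmüller theory III*, kurims manuscript (May 2020), Proposition 3.9 (i) p. 116 and Remark
3.9.5 (i) p. 127 (hull-sets); *Inter-universal Teichmüller theory IV*, Proposition 1.5 (iii) p. 15 and Step (vii) of the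
proof of Theorem 1.10, p. 30. [claim: Mochizuki2012, status: disputed]

WHAT THIS FILE PROVES. abc-iut-c312 / abc-iut-w5-d163's archimedean container at the label `j` of the real setting
(`Cor312Vol.ArchPresentation.logμ (infty) j` on `M_I = ⊗_{a ∈ S^±_{j+1}, ℝ} (⊕_{v | ∞} ℂ_v)`, `Cor312VolumesArchSummands.lean`,
used by abc-iut-c312-1's `Thm311RealDegreeArch.lean`) is, BY DEFINITION, abc-iut-L5-t7's single-container log-volume
`packetLogVol (canonicalDecomposition (S^±_{j+1}) (Fibre ∞))`; abc-iut-L6-d3's CAP39 part X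
(`PacketLogVolumesHaarModelCapsulesArchHulls.lean`, p430328/p430417) proves that on every HULL region this equals the
GENUINE capsule log-volume `μ^log_{A,∞}` (portions `⊗_{a,ℝ}ℂ` averaged with the Remark 3.1.1 (ii) weights) for totally
complex `F`. Here the instantiation at the real `thetaIndex X`:
* `fibreInftyEquivPacket X : (thetaIndex X).Fibre ∞ ≃ Packet F ∞` — the archimedean fibre of the crew's index skeleton IS
  L6's packet over `∞` (the crew's `Place.under` and L6's `ratPlaceBelow` have the same defining clauses);
* **`archPresentation_logμ_archHullRegion`**: for every label `j`, every hull region of the crew's container (polydisc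
  radii `r(π, ε) > 0` in the coordinates of L5-t7's canonical decomposition) and totally complex `F` ([IUTchI] Def. 3.1
  (a)), `ArchPresentation.logμ ∞ j (hull r) = capsulePacketLogVolume F (S^±_{j+1}) ∞ (hull family r)` — the archimedean
  counterpart of the prime-side junction `Thm311RealCapsuleJunction.lean` (p423698).
So at EVERY `v_ℚ ∈ 𝕍_ℚ` the containers in which the crew computes Theorem 3.11 (i)(c) / Corollary 3.12's volumes give the
regions that occur (ideal boxes at the primes, hull-sets at `∞`) the log-volumes of the genuine model of [IUTchIII]
Prop. 3.9. Nothing here takes a side on [IUTchIII] Cor. 3.12; typed ≠ endorsed. [cite: Mochizuki2012, IUTchIV Prop. 1.5 (iii) p. 15]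
-/

noncomputable section

open Set Function NumberField IsDedekindDomain

namespace Summit.ABC.IUTFork.Thm311.Real

open Cor312Vol Literature.IUT.LogThetaLattice Literature.IUT.LogVolume Literature.IUT.LogVolume.Prop15iii

variable {F : Type} [Field F] [NumberField F] (X : PilotData F)

attribute [local instance] Cor312Vol.ArchPresentation.fibreFintype

/-- The crew's `Place.under` IS L6's `ratPlaceBelow` (same defining clauses). [folklore] -/
theorem under_eq_ratPlaceBelow (v : Place F) : Place.under v = ratPlaceBelow F v := by
  rcases v with w | w <;> rfl

/-- **The archimedean fibre of the crew's index skeleton IS L6's packet over `∞`** (identity on the underlying places).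
[claim: Mochizuki2012, status: disputed] -/
def fibreInftyEquivPacket : (thetaIndex X).Fibre (Sum.inl ()) ≃ Packet F RatPlace.infty :=
  Equiv.subtypeEquivRight fun v => by
    show Place.under v = Sum.inl () ↔ ratPlaceBelow F v = RatPlace.infty
    rw [under_eq_ratPlaceBelow]

/-- Underlying place of the identification (definitional). [claim: Mochizuki2012, status: disputed] -/
@[simp] theorem fibreInftyEquivPacket_coe (v : (thetaIndex X).Fibre (Sum.inl ())) :
    ((fibreInftyEquivPacket X v : Packet F RatPlace.infty) : Place F) = v.1 := rfl

/-- The induced identification of portion sets: tuples `S^±_{j+1} → Fibre ∞` of the crew ARE L6's portions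
`Portion F (S^±_{j+1}) ∞`. [claim: Mochizuki2012, status: disputed] -/
def portionInftyEquivFibre (j : (thetaIndex X).Label) :
    Portion F ((thetaIndex X).Caps j) RatPlace.infty ≃ ((thetaIndex X).Caps j → (thetaIndex X).Fibre (Sum.inl ())) :=
  Equiv.piCongrRight fun _ => (fibreInftyEquivPacket X).symm

/-- **THE ARCHIMEDEAN JUNCTION L6 ↔ C312.** For totally complex `F`, every label `j` and every hull region (polydisc radii
`r(π, ε) > 0` in L5-t7's coordinates `(S^±_{j+1} → Fibre ∞) × {±}'`), the crew's archimedean log-measure of the hull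
region EQUALS the genuine capsule log-volume `μ^log_{S^±_{j+1},∞}` (abc-iut-L6-d3 p419250) of the corresponding hull
family (CAP39 part X `capsulePacketLogVolume_infty_archHullFamilyOfEquiv`; `logμ` is `packetLogVol ∘ Φ₀` by definition).
[claim: Mochizuki2012, status: disputed] -/
theorem archPresentation_logμ_archHullRegion (hc : ∀ w : InfinitePlace F, w.IsComplex) (j : (thetaIndex X).Label)
    (r : ((thetaIndex X).Caps j → (thetaIndex X).Fibre (Sum.inl ())) → Signs ((thetaIndex X).Caps j) → ℝ)
    (hr : ∀ π ε, 0 < r π ε) :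
    ArchPresentation.logμ (T := thetaIndex X) (Sum.inl ()) j
        (archHullRegion ((thetaIndex X).Caps j) ((thetaIndex X).Fibre (Sum.inl ())) r) =
      capsulePacketLogVolume F ((thetaIndex X).Caps j) RatPlace.infty
        (archHullFamilyOfEquiv F ((thetaIndex X).Caps j) (portionInftyEquivFibre X j) r hr) :=
  (capsulePacketLogVolume_infty_archHullFamilyOfEquiv F ((thetaIndex X).Caps j) hc (portionInftyEquivFibre X j) r hr).symm

/-- The hull region is ADMISSIBLE for the crew's archimedean admissibility (positive finite Lebesgue volume in the
coordinates). [claim: Mochizuki2012, status: disputed] -/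
theorem adm_archHullRegion (j : (thetaIndex X).Label)
    (r : ((thetaIndex X).Caps j → (thetaIndex X).Fibre (Sum.inl ())) → Signs ((thetaIndex X).Caps j) → ℝ)
    (hr : ∀ π ε, 0 < r π ε) :
    ArchPresentation.adm (T := thetaIndex X) (Sum.inl ()) j
      (archHullRegion ((thetaIndex X).Caps j) ((thetaIndex X).Fibre (Sum.inl ())) r) := by
  have h := volume_image_archHullRegion_pos_lt_top ((thetaIndex X).Caps j) ((thetaIndex X).Fibre (Sum.inl ())) r hr
  exact ⟨h.1.ne', h.2.ne⟩

end Summit.ABC.IUTFork.Thm311.Real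

end
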